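import Summits.CriticalPhenomena.PercolationContinuityZ3.Theorems.PercNearOneGluingAdditiveGluingThreePointTransfer
import HarnessLib

/-!
# Crux `PercNearOneGluing.AdditiveGluing` (stmt-CriticalPhenomena-4576): the three-point transfer conditioned on an increasing event (3PT_U)

Support file (`--supports stmt-CriticalPhenomena-4576`, helper; depth seat (d) exchange-certificate form).
No definitions, no named facts, no sorries.

Weighted graph on `Fin n` (`μ = prodBernoulli w`), relays `u, v`, observer `o`, spectator `c`; `D = {u ↮ v}`,
`N = {c ↮ u} ∩ {c ↮ v}` ("`c` free"), `L = C_v` (open edge cluster), `π = μ(D ∩ N ∩ {o↔c}) / μ(D ∩ N)`.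
The kernel stub `stub_k0CovTransferQ_c9` (= (T)) of the three-relay half is implied (lead c11, `LeadMath-c11` §1–§2) by
the dominance statement

  (SD)  `Cov_D(1_U, 1{o ∈ L}) ≥ π · Cov_D(1_U, 1{c ∈ L})`  for every event `U` increasing in `L`  (`P_D = μ( · | D)`).

The landed three-point transfer `threePointTransfer` (3PT, p184176) is the instance `U = {c ∈ L}`.  This file proves (SD) for
EVERY increasing `U ⊆ {c ∈ L}`, i.e. for `U ∩ {v ↔ c}` with `U` an arbitrary increasing event of `C_v`:

  (3PT_U)  `P_D(o ∈ L | U, c ∈ L) ≥ P_D(o ∈ L) + π · P_D(c ∉ L)`,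

in the division-free form
`(μ(D∩N)·μ(D ∩ {v↔o}) + μ(D∩N∩{o↔c})·μ(D ∩ {v↮c})) · μ(D ∩ {v↔c} ∩ U) ≤ μ(D∩N) · μ(D) · μ(D ∩ {v↔o} ∩ {v↔c} ∩ U)`
(`threePointTransfer_upset`).  At `U = univ` it is 3PT (`P_D(o∈L | c∈L) − P_D(o∈L) = P_D(c∉L)·(P_D(o∈L|c∈L) − P_D(o∈L|c∉L))`);
as a statement about (SD) it says `Cov_D(1_{U ∩ {c∈L}}, 1{o∈L} − π1{c∈L}) ≥ 0`, i.e. the part of the (SD) mass-transport that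
lives inside the world `{c ∈ L}` closes on its own ("the `c ∈ L` world is self-sufficient"); the open residual of (SD) is the
coupling of the `{c ∉ L}` world (memo EXCHCERT-g5 §3–§5 on the item).  The mirror case — (SD) for every increasing event
CONTAINING `{c ∈ L}`, i.e. for `{v↔c} ∪ U` — is `covTransfer_upset_sup` below (positive association of `C_v` given
`C_v ∩ {u,c} = ∅`, van den Berg–Häggström–Kahn Thm. 1.3, plus 3PT); so (SD) holds for every increasing event comparable with
`{c ∈ L}` under inclusion, and the open residual is the "transversal" case.

Proof.  (I_U) The set cluster `S = C_{{v,c}}` is positively associated given `u ∉ S` (van den Berg–Häggström–Kahn Thm. 2.1 at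
`q = 1` with vertex sets, in the tree `setTwoClusterExchange`); an event increasing in `C_v` is increasing in `S`
(`TwoSetExchange.openEdgeCluster_mono_of_biUnion`), so `{v↔c} ∩ U` and `{o ∈ S}` are both of type `(+)` and
`μ({u∉S} ∩ v↔c ∩ U) · μ({u∉S} ∩ {o∈S}) ≤ μ({u∉S} ∩ v↔c ∩ U ∩ {o∈S}) · μ({u∉S})`.  Combined with the two inequalities of the
3PT file (`real_I_obs_ge`: on `{u∉S}` the event `{o∈S}` contains the disjoint pieces `D∩v↔o∩v↔c`, `D∩N∩v↔o`, `D∩N∩o↔c`;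
`stepII`: guarded exchange `μ(D∩v↮c∩v↔o)·μ(D∩N) ≤ μ(D∩N∩v↔o)·μ(D∩v↮c)`), with 3PT itself and `μ(D∩N) ≤ μ(D∩{v↮c})`, the claim is
the polynomial identity
`μ(F)·μ(D∩v↮c)·[goal] = μ(D∩N)·μ(D)·[slack of (I_U)] + μ(D∩v↔c∩U)·(μ(D∩v↮c) − μ(D∩N))·[slack of 3PT]`, `μ(F) = μ(D∩v↔c) + μ(D∩N)`.
[cite: VandenbergHaggstromKahn2005, Thm. 1.3 (p. 6), Thm. 1.5 (p. 7), Thm. 2.1 (p. 9) with Remark 1 after Thm. 1.2 (p. 5)]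
[cite: KozmaNitzan2024, Question 7 (p. 36)]
-/

namespace Summit.CriticalPhenomena.PercolationContinuityZ3.Theorems

open MeasureTheory Set Literature.Probability.LatticeModels Literature.Probability.Percolation
open Summit.CriticalPhenomena.PercolationContinuityZ3.Cruxes.AdditiveGluing.TieLine
open Summit.CriticalPhenomena.PercolationContinuityZ3.Cruxes.AdditiveGluing.TieLine.ThreePointTransfer

noncomputable section

namespace ThreePointTransferUpset

variable {n : ℕ}

/-- **(I_U)** Set-BHK for `S = {v,c}`, `T = {u}` with an arbitrary event `U` increasing in `C_v`:
`μ({u∉S} ∩ (v↔c ∩ U)) · μ({u∉S} ∩ {o ∈ S}) ≤ μ({u∉S} ∩ (v↔c ∩ U ∩ {o∈S})) · μ({u∉S})`.  An event increasing in `C_v` is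
increasing in `C_S` (`openEdgeCluster_mono_of_biUnion`), hence of type `(+)`.
[cite: VandenbergHaggstromKahn2005, Thm. 2.1 (p. 9) at q = 1] -/
theorem stepI_upset (w : Sym2 (Fin n) → unitInterval) (o u v c : Fin n) (U : Set (BondConfig (Fin n)))
    (hU : ∀ ⦃ω ω' : BondConfig (Fin n)⦄, openEdgeCluster ω v ⊆ openEdgeCluster ω' v → ω ∈ U → ω' ∈ U) :
    (prodBernoulli w).real ((openConn v u)ᶜ ∩ (openConn c u)ᶜ ∩ (openConn v c ∩ U)) *
        (prodBernoulli w).real ((openConn v u)ᶜ ∩ (openConn c u)ᶜ ∩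
          ⋃ s ∈ ({v, c} : Set (Fin n)), (openConn s o : Set (BondConfig (Fin n)))) ≤
      (prodBernoulli w).real ((openConn v u)ᶜ ∩ (openConn c u)ᶜ ∩
          ((openConn v c ∩ U) ∩ ⋃ s ∈ ({v, c} : Set (Fin n)), (openConn s o : Set (BondConfig (Fin n))))) *
        (prodBernoulli w).real ((openConn v u)ᶜ ∩ (openConn c u)ᶜ : Set (BondConfig (Fin n))) := by
  have hvS : v ∈ ({v, c} : Set (Fin n)) := by simp
  have key := setTwoClusterExchange w ({v, c} : Set (Fin n)) ({u} : Set (Fin n))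
    (A₁ := openConn v c ∩ U) (A₂ := ⋃ s ∈ ({v, c} : Set (Fin n)), (openConn s o : Set (BondConfig (Fin n))))
    (B₁ := univ) (B₂ := univ)
    (fun ω ω' hs ht h =>
      ⟨TwoSetExchange.typePlus_openConn_of_mem ({v, c} : Set (Fin n)) ({u} : Set (Fin n)) hvS c hs ht h.1,
        hU (TwoSetExchange.openEdgeCluster_mono_of_biUnion hvS hs) h.2⟩)
    (TwoSetExchange.typePlus_biUnion_openConn _ _ o)
    (fun _ _ _ _ _ => mem_univ _) (fun _ _ _ _ _ => mem_univ _)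
  simpa only [sep_vc_u_eq, inter_univ, univ_inter] using key

/-- `{v↮u} ∩ {c↮u} ∩ ({v↔c} ∩ U) = D ∩ {v↔c} ∩ U`. [folklore] -/
theorem IU_left_eq (u v c : Fin n) (U : Set (BondConfig (Fin n))) :
    ((openConn v u)ᶜ ∩ (openConn c u)ᶜ ∩ (openConn v c ∩ U) : Set (BondConfig (Fin n))) =
      (openConn u v)ᶜ ∩ openConn v c ∩ U := by
  rw [← inter_assoc, I_left_eq u v c]

/-- `{v↮u} ∩ {c↮u} ∩ (({v↔c} ∩ U) ∩ {o ∈ S}) = D ∩ {v↔o} ∩ {v↔c} ∩ U`. [folklore] -/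
theorem IU_mid_eq (o u v c : Fin n) (U : Set (BondConfig (Fin n))) :
    ((openConn v u)ᶜ ∩ (openConn c u)ᶜ ∩
        ((openConn v c ∩ U) ∩ ⋃ s ∈ ({v, c} : Set (Fin n)), (openConn s o : Set (BondConfig (Fin n)))) :
          Set (BondConfig (Fin n))) =
      (openConn u v)ᶜ ∩ openConn v o ∩ openConn v c ∩ U := by
  have h := I_mid_eq o u v c
  have e1 : ((openConn v u)ᶜ ∩ (openConn c u)ᶜ ∩
      ((openConn v c ∩ U) ∩ ⋃ s ∈ ({v, c} : Set (Fin n)), (openConn s o : Set (BondConfig (Fin n)))) :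
        Set (BondConfig (Fin n))) =
      ((openConn v u)ᶜ ∩ (openConn c u)ᶜ ∩
        (openConn v c ∩ ⋃ s ∈ ({v, c} : Set (Fin n)), (openConn s o : Set (BondConfig (Fin n))))) ∩ U := by
    ext ω; simp only [mem_inter_iff]; tauto
  rw [e1, h]

/-- Monotonicity `μ(D ∩ N ∩ {o↔c}) ≤ μ(D ∩ N) ≤ μ(D ∩ {v↮c})`. [folklore] -/
theorem real_free_le (w : Sym2 (Fin n) → unitInterval) (o u v c : Fin n) :
    (prodBernoulli w).real ((openConn u v)ᶜ ∩ ((openConn c u)ᶜ ∩ (openConn c v)ᶜ) ∩ openConn o c :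
        Set (BondConfig (Fin n))) ≤
      (prodBernoulli w).real ((openConn u v)ᶜ ∩ ((openConn c u)ᶜ ∩ (openConn c v)ᶜ) : Set (BondConfig (Fin n))) ∧
    (prodBernoulli w).real ((openConn u v)ᶜ ∩ ((openConn c u)ᶜ ∩ (openConn c v)ᶜ) : Set (BondConfig (Fin n))) ≤
      (prodBernoulli w).real ((openConn u v)ᶜ ∩ (openConn v c)ᶜ : Set (BondConfig (Fin n))) := by
  refine ⟨measureReal_mono inter_subset_left, measureReal_mono ?_⟩
  rintro ω ⟨huv, -, hcv⟩
  refine ⟨huv, ?_⟩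
  simp only [mem_compl_iff, openConn, mem_setOf_eq] at hcv ⊢
  exact fun hvc => hcv hvc.symm

/-- `μ(D ∩ {v↔c} ∩ U) ≤ μ(D ∩ {v↔c})`. [folklore] -/
theorem real_pcU_le (w : Sym2 (Fin n) → unitInterval) (u v c : Fin n) (U : Set (BondConfig (Fin n))) :
    (prodBernoulli w).real ((openConn u v)ᶜ ∩ openConn v c ∩ U : Set (BondConfig (Fin n))) ≤
      (prodBernoulli w).real ((openConn u v)ᶜ ∩ openConn v c : Set (BondConfig (Fin n))) :=
  measureReal_mono inter_subset_left

end ThreePointTransferUpset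

open ThreePointTransferUpset in
/-- **Three-point transfer conditioned on an increasing event (3PT_U)** (crux `AdditiveGluing`, kernel (T) via c11's (SD)):
for every event `U` increasing in the open cluster `C_v` (`C_v ω ⊆ C_v ω' → ω ∈ U → ω' ∈ U`), with `D = {u ↮ v}`,
`N = {c ↮ u} ∩ {c ↮ v}`:
`(μ(D∩N)·μ(D∩{v↔o}) + μ(D∩N∩{o↔c})·μ(D∩{v↮c})) · μ(D∩{v↔c}∩U) ≤ μ(D∩N)·μ(D)·μ(D∩{v↔o}∩{v↔c}∩U)`,
i.e. `P_D(o ∈ C_v | U, c ∈ C_v) ≥ P_D(o ∈ C_v) + P_D(o↔c | c free)·P_D(c ∉ C_v)`; equivalently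
`Cov_D(1_{U∩{c∈C_v}}, 1{o∈C_v}) ≥ P_D(o↔c | c free)·Cov_D(1_{U∩{c∈C_v}}, 1{c∈C_v})`: the dominance form (SD) of the kernel stub
`stub_k0CovTransferQ_c9` holds for every increasing event contained in `{c ∈ C_v}`.  `U = univ` is `threePointTransfer`.
[cite: VandenbergHaggstromKahn2005, Thm. 1.3 (p. 6), Thm. 1.5 (p. 7), Thm. 2.1 (p. 9)] [cite: KozmaNitzan2024, Question 7 (p. 36)] -/
theorem threePointTransfer_upset : ∀ (n : ℕ) (w : Sym2 (Fin n) → unitInterval) (o u v c : Fin n)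
    (U : Set (BondConfig (Fin n))),
    (∀ ⦃ω ω' : BondConfig (Fin n)⦄, openEdgeCluster ω v ⊆ openEdgeCluster ω' v → ω ∈ U → ω' ∈ U) →
    ((prodBernoulli w).real ((openConn u v)ᶜ ∩ ((openConn c u)ᶜ ∩ (openConn c v)ᶜ) : Set (BondConfig (Fin n))) *
          (prodBernoulli w).real ((openConn u v)ᶜ ∩ openConn v o : Set (BondConfig (Fin n))) +
        (prodBernoulli w).real ((openConn u v)ᶜ ∩ ((openConn c u)ᶜ ∩ (openConn c v)ᶜ) ∩ openConn o c :
            Set (BondConfig (Fin n))) *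
          (prodBernoulli w).real ((openConn u v)ᶜ ∩ (openConn v c)ᶜ : Set (BondConfig (Fin n)))) *
      (prodBernoulli w).real ((openConn u v)ᶜ ∩ openConn v c ∩ U : Set (BondConfig (Fin n))) ≤
    (prodBernoulli w).real ((openConn u v)ᶜ ∩ ((openConn c u)ᶜ ∩ (openConn c v)ᶜ) : Set (BondConfig (Fin n))) *
      (prodBernoulli w).real ((openConn u v)ᶜ : Set (BondConfig (Fin n))) *
        (prodBernoulli w).real ((openConn u v)ᶜ ∩ openConn v o ∩ openConn v c ∩ U : Set (BondConfig (Fin n))) := by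
  intro n w o u v c U hU
  have hIU := stepI_upset w o u v c U hU
  have hII := stepII w o u v c
  have h3 := threePointTransfer n w o u v c
  rw [IU_left_eq u v c U, IU_mid_eq o u v c U, real_I_right_eq w u v c] at hIU
  rw [II_left_eq o u v c, II_free_eq u v c, II_mid_eq o u v c, II_base_eq u v c] at hII
  have hge := real_I_obs_ge w o u v c
  obtain ⟨hD, hDo⟩ := real_D_split w o u v c
  obtain ⟨htoc_le, ht_le⟩ := real_free_le w o u v c
  have hpcU_le := real_pcU_le w u v c U
  set μ := prodBernoulli w with hμ
  set poc := μ.real ((openConn u v)ᶜ ∩ openConn v o ∩ openConn v c : Set (BondConfig (Fin n))) with hpoc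
  set pc := μ.real ((openConn u v)ᶜ ∩ openConn v c : Set (BondConfig (Fin n))) with hpc
  set pcb := μ.real ((openConn u v)ᶜ ∩ (openConn v c)ᶜ : Set (BondConfig (Fin n))) with hpcb
  set t := μ.real ((openConn u v)ᶜ ∩ ((openConn c u)ᶜ ∩ (openConn c v)ᶜ) : Set (BondConfig (Fin n))) with ht
  set tov := μ.real ((openConn u v)ᶜ ∩ ((openConn c u)ᶜ ∩ (openConn c v)ᶜ) ∩ openConn v o : Set (BondConfig (Fin n)))
    with htov
  set toc := μ.real ((openConn u v)ᶜ ∩ ((openConn c u)ᶜ ∩ (openConn c v)ᶜ) ∩ openConn o c : Set (BondConfig (Fin n)))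
    with htoc
  set pocb := μ.real ((openConn u v)ᶜ ∩ (openConn v c)ᶜ ∩ openConn v o : Set (BondConfig (Fin n))) with hpocb
  set obs := μ.real ((openConn v u)ᶜ ∩ (openConn c u)ᶜ ∩
    ⋃ s ∈ ({v, c} : Set (Fin n)), (openConn s o : Set (BondConfig (Fin n)))) with hobs
  set pcU := μ.real ((openConn u v)ᶜ ∩ openConn v c ∩ U : Set (BondConfig (Fin n))) with hpcU
  set pocU := μ.real ((openConn u v)ᶜ ∩ openConn v o ∩ openConn v c ∩ U : Set (BondConfig (Fin n))) with hpocU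
  set d := μ.real ((openConn u v)ᶜ : Set (BondConfig (Fin n))) with hd
  set dvo := μ.real ((openConn u v)ᶜ ∩ openConn v o : Set (BondConfig (Fin n))) with hdvo
  -- hIU : pcU * obs ≤ pocU * (pc + t);  hge : poc + tov + toc ≤ obs;  hII : pocb * t ≤ tov * pcb
  -- h3 : toc * (pc * pcb) ≤ t * (d * poc - dvo * pc);  hD : d = pc + pcb;  hDo : dvo = poc + pocb
  have hpc0 : 0 ≤ pc := measureReal_nonneg
  have hpcb0 : 0 ≤ pcb := measureReal_nonneg
  have ht0 : 0 ≤ t := measureReal_nonneg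
  have htoc0 : 0 ≤ toc := measureReal_nonneg
  have hpcU0 : 0 ≤ pcU := measureReal_nonneg
  have hpocU0 : 0 ≤ pocU := measureReal_nonneg
  have hd0 : 0 ≤ d := measureReal_nonneg
  -- slack of (I_U): pcU * (poc*pcb + pocb*t + toc*pcb) ≤ pocU * (pc + t) * pcb
  have h1 : pcU * (poc * pcb + pocb * t + toc * pcb) ≤ pocU * (pc + t) * pcb := by
    have a1 : pcU * (poc + tov + toc) ≤ pocU * (pc + t) :=
      (mul_le_mul_of_nonneg_left hge hpcU0).trans hIU
    nlinarith [mul_le_mul_of_nonneg_left a1 hpcb0, mul_le_mul_of_nonneg_left hII hpcU0]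
  -- the key polynomial identity, multiplied by (pc + t) * pcb
  have key : 0 ≤ (pc + t) * pcb * (t * d * pocU - (t * dvo + toc * pcb) * pcU) := by
    have e3 : 0 ≤ pcU * ((pcb - t) * (t * (d * poc - dvo * pc) - toc * (pc * pcb))) :=
      mul_nonneg hpcU0 (mul_nonneg (sub_nonneg.2 ht_le) (sub_nonneg.2 h3))
    have e1 : 0 ≤ t * d * (pocU * (pc + t) * pcb - pcU * (poc * pcb + pocb * t + toc * pcb)) :=
      mul_nonneg (mul_nonneg ht0 hd0) (sub_nonneg.2 h1)
    have iden : (pc + t) * pcb * (t * d * pocU - (t * dvo + toc * pcb) * pcU) =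
        t * d * (pocU * (pc + t) * pcb - pcU * (poc * pcb + pocb * t + toc * pcb)) +
          pcU * ((pcb - t) * (t * (d * poc - dvo * pc) - toc * (pc * pcb))) := by
      rw [hD, hDo]; ring
    rw [iden]; exact add_nonneg e1 e3
  -- conclude: divide by (pc + t) * pcb when positive; the degenerate case is `0 ≤ 0`-like
  rcases eq_or_lt_of_le (mul_nonneg (add_nonneg hpc0 ht0) hpcb0) with h0 | hpos
  · -- (pc + t) * pcb = 0 : then t = 0 and toc = 0
    have ht_zero : t = 0 := by
      rcases mul_eq_zero.1 h0.symm with h | h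
      · linarith
      · linarith
    have htoc_zero : toc = 0 := le_antisymm (ht_zero ▸ htoc_le) htoc0
    rw [ht_zero, htoc_zero]
    nlinarith
  · have := (mul_nonneg_iff_of_pos_left hpos).1 key
    linarith

namespace ThreePointTransferUpset

variable {n : ℕ}

/-- **PA in the `c ∉ L` world.**  Guarded BHK for `S = {v}`, `T = {u,c}`, pair `(v,u)`: an event `U` increasing in `C_v` and
`{v↔o}` are both of type `(+)`, so `μ({v↮u,v↮c} ∩ U) · μ({v↮u,v↮c} ∩ v↔o) ≤ μ({v↮u,v↮c} ∩ (U ∩ v↔o)) · μ({v↮u,v↮c})`.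
[cite: VandenbergHaggstromKahn2005, Thm. 1.3 (p. 6), Thm. 2.1 (p. 9) at q = 1] -/
theorem stepPA_cbar (w : Sym2 (Fin n) → unitInterval) (o u v c : Fin n) (U : Set (BondConfig (Fin n)))
    (hU : ∀ ⦃ω ω' : BondConfig (Fin n)⦄, openEdgeCluster ω v ⊆ openEdgeCluster ω' v → ω ∈ U → ω' ∈ U) :
    (prodBernoulli w).real ((openConn u v)ᶜ ∩ (openConn v c)ᶜ ∩ U) *
        (prodBernoulli w).real ((openConn u v)ᶜ ∩ (openConn v c)ᶜ ∩ openConn v o) ≤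
      (prodBernoulli w).real ((openConn u v)ᶜ ∩ (openConn v c)ᶜ ∩ (U ∩ openConn v o)) *
        (prodBernoulli w).real ((openConn u v)ᶜ ∩ (openConn v c)ᶜ : Set (BondConfig (Fin n))) := by
  have key := guardedTwoClusterExchange w ({v} : Set (Fin n)) ({u, c} : Set (Fin n)) (s := v) (t := u)
    (by simp) (by simp)
    (A₁ := U) (A₂ := openConn v o) (B₁ := univ) (B₂ := univ)
    (fun _ _ h1 _ hω => hU h1 hω) (typePlus_openConn v u o)
    (fun _ _ _ _ _ => mem_univ _) (fun _ _ _ _ _ => mem_univ _)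
  simp only [sep_v_uc_eq, inter_univ] at key
  rwa [II_base_eq u v c] at key

/-- `μ(D ∩ ({v↔c} ∪ U)) = μ(D ∩ {v↔c}) + μ(D ∩ {v↮c} ∩ U)`. [folklore] -/
theorem real_union_split (w : Sym2 (Fin n) → unitInterval) (u v c : Fin n) (U : Set (BondConfig (Fin n))) :
    (prodBernoulli w).real ((openConn u v)ᶜ ∩ (openConn v c ∪ U) : Set (BondConfig (Fin n))) =
      (prodBernoulli w).real ((openConn u v)ᶜ ∩ openConn v c : Set (BondConfig (Fin n))) +
        (prodBernoulli w).real ((openConn u v)ᶜ ∩ (openConn v c)ᶜ ∩ U : Set (BondConfig (Fin n))) := by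
  rw [ML5EdgeIdentity.real_eq_inter_add_inter_compl w ((openConn u v)ᶜ ∩ (openConn v c ∪ U) : Set (BondConfig (Fin n)))
    (openConn v c)]
  congr 2
  · ext ω; simp only [mem_inter_iff, mem_union]; tauto
  · ext ω; simp only [mem_inter_iff, mem_union, mem_compl_iff]; tauto

/-- `μ(D ∩ ({v↔c} ∪ U) ∩ {v↔o}) = μ(D ∩ {v↔o} ∩ {v↔c}) + μ(D ∩ {v↮c} ∩ (U ∩ {v↔o}))`. [folklore] -/
theorem real_union_split_o (w : Sym2 (Fin n) → unitInterval) (o u v c : Fin n) (U : Set (BondConfig (Fin n))) :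
    (prodBernoulli w).real ((openConn u v)ᶜ ∩ (openConn v c ∪ U) ∩ openConn v o : Set (BondConfig (Fin n))) =
      (prodBernoulli w).real ((openConn u v)ᶜ ∩ openConn v o ∩ openConn v c : Set (BondConfig (Fin n))) +
        (prodBernoulli w).real ((openConn u v)ᶜ ∩ (openConn v c)ᶜ ∩ (U ∩ openConn v o) : Set (BondConfig (Fin n))) := by
  rw [ML5EdgeIdentity.real_eq_inter_add_inter_compl w
    ((openConn u v)ᶜ ∩ (openConn v c ∪ U) ∩ openConn v o : Set (BondConfig (Fin n))) (openConn v c)]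
  congr 2
  · ext ω; simp only [mem_inter_iff, mem_union]; tauto
  · ext ω; simp only [mem_inter_iff, mem_union, mem_compl_iff]; tauto

/-- `D ∩ ({v↔c} ∪ U) ∩ {v↔c} = D ∩ {v↔c}`. [folklore] -/
theorem union_inter_vc (u v c : Fin n) (U : Set (BondConfig (Fin n))) :
    ((openConn u v)ᶜ ∩ (openConn v c ∪ U) ∩ openConn v c : Set (BondConfig (Fin n))) = (openConn u v)ᶜ ∩ openConn v c := by
  ext ω; simp only [mem_inter_iff, mem_union]; tauto

/-- `μ(D ∩ {v↮c} ∩ U) ≤ μ(D ∩ {v↮c})` and `μ(D ∩ {v↮c} ∩ (U ∩ v↔o)) ≤ μ(D ∩ {v↮c} ∩ U)`. [folklore] -/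
theorem real_fU_le (w : Sym2 (Fin n) → unitInterval) (o u v c : Fin n) (U : Set (BondConfig (Fin n))) :
    (prodBernoulli w).real ((openConn u v)ᶜ ∩ (openConn v c)ᶜ ∩ U : Set (BondConfig (Fin n))) ≤
      (prodBernoulli w).real ((openConn u v)ᶜ ∩ (openConn v c)ᶜ : Set (BondConfig (Fin n))) ∧
    (prodBernoulli w).real ((openConn u v)ᶜ ∩ (openConn v c)ᶜ ∩ (U ∩ openConn v o) : Set (BondConfig (Fin n))) ≤
      (prodBernoulli w).real ((openConn u v)ᶜ ∩ (openConn v c)ᶜ ∩ U : Set (BondConfig (Fin n))) :=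
  ⟨measureReal_mono inter_subset_left, measureReal_mono (inter_subset_inter_right _ inter_subset_left)⟩

end ThreePointTransferUpset

open ThreePointTransferUpset in
/-- **(SD) for every increasing event containing `{c ∈ C_v}`** (crux `AdditiveGluing`, kernel (T) via c11's (SD)): for every
event `U` increasing in the open cluster `C_v` and `U' = {v↔c} ∪ U`, with `D = {u ↮ v}`, `N = {c ↮ u} ∩ {c ↮ v}`:
`μ(D∩N) · (μ(D)·μ(D∩U'∩{v↔o}) − μ(D∩U')·μ(D∩{v↔o})) ≥ μ(D∩N∩{o↔c}) · (μ(D)·μ(D∩U'∩{v↔c}) − μ(D∩U')·μ(D∩{v↔c}))`,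
i.e. `Cov_D(1_{U'}, 1{o∈C_v}) ≥ P_D(o↔c | c free) · Cov_D(1_{U'}, 1{c∈C_v})`.  Equivalent to
`θ·S₃·(1 − P_D(U | c∉C_v)) + Cov_D(1_U, 1{o∈C_v} | c∉C_v) ≥ 0` (`S₃` = slack of 3PT), whence the proof: positive association of
`C_v` given `C_v ∩ {u,c} = ∅` (`stepPA_cbar`) + `threePointTransfer` + the identity
`μ(D∩{v↮c})·[goal] = Σ₃·(μ(D∩{v↮c}) − μ(D∩{v↮c}∩U)) + μ(D)·μ(D∩N)·[slack of stepPA_cbar]`, `Σ₃` the division-free 3PT slack.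
With `threePointTransfer_upset`: (SD) holds for every increasing event comparable with `{c ∈ C_v}` under inclusion.
[cite: VandenbergHaggstromKahn2005, Thm. 1.3 (p. 6), Thm. 2.1 (p. 9)] [cite: KozmaNitzan2024, Question 7 (p. 36)] -/
theorem covTransfer_upset_sup : ∀ (n : ℕ) (w : Sym2 (Fin n) → unitInterval) (o u v c : Fin n)
    (U : Set (BondConfig (Fin n))),
    (∀ ⦃ω ω' : BondConfig (Fin n)⦄, openEdgeCluster ω v ⊆ openEdgeCluster ω' v → ω ∈ U → ω' ∈ U) →
    (prodBernoulli w).real ((openConn u v)ᶜ ∩ ((openConn c u)ᶜ ∩ (openConn c v)ᶜ) ∩ openConn o c :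
          Set (BondConfig (Fin n))) *
        ((prodBernoulli w).real ((openConn u v)ᶜ : Set (BondConfig (Fin n))) *
            (prodBernoulli w).real ((openConn u v)ᶜ ∩ (openConn v c ∪ U) ∩ openConn v c : Set (BondConfig (Fin n))) -
          (prodBernoulli w).real ((openConn u v)ᶜ ∩ (openConn v c ∪ U) : Set (BondConfig (Fin n))) *
            (prodBernoulli w).real ((openConn u v)ᶜ ∩ openConn v c : Set (BondConfig (Fin n)))) ≤
      (prodBernoulli w).real ((openConn u v)ᶜ ∩ ((openConn c u)ᶜ ∩ (openConn c v)ᶜ) : Set (BondConfig (Fin n))) *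
        ((prodBernoulli w).real ((openConn u v)ᶜ : Set (BondConfig (Fin n))) *
            (prodBernoulli w).real ((openConn u v)ᶜ ∩ (openConn v c ∪ U) ∩ openConn v o : Set (BondConfig (Fin n))) -
          (prodBernoulli w).real ((openConn u v)ᶜ ∩ (openConn v c ∪ U) : Set (BondConfig (Fin n))) *
            (prodBernoulli w).real ((openConn u v)ᶜ ∩ openConn v o : Set (BondConfig (Fin n)))) := by
  intro n w o u v c U hU
  have hPA := stepPA_cbar w o u v c U hU
  have h3 := threePointTransfer n w o u v c
  obtain ⟨hD, hDo⟩ := real_D_split w o u v c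
  obtain ⟨htoc_le, ht_le⟩ := real_free_le w o u v c
  obtain ⟨hfU_le, hfUo_le⟩ := real_fU_le w o u v c U
  rw [real_union_split w u v c U, real_union_split_o w o u v c U, union_inter_vc u v c U]
  set μ := prodBernoulli w with hμ
  set poc := μ.real ((openConn u v)ᶜ ∩ openConn v o ∩ openConn v c : Set (BondConfig (Fin n))) with hpoc
  set pc := μ.real ((openConn u v)ᶜ ∩ openConn v c : Set (BondConfig (Fin n))) with hpc
  set pcb := μ.real ((openConn u v)ᶜ ∩ (openConn v c)ᶜ : Set (BondConfig (Fin n))) with hpcb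
  set t := μ.real ((openConn u v)ᶜ ∩ ((openConn c u)ᶜ ∩ (openConn c v)ᶜ) : Set (BondConfig (Fin n))) with ht
  set toc := μ.real ((openConn u v)ᶜ ∩ ((openConn c u)ᶜ ∩ (openConn c v)ᶜ) ∩ openConn o c : Set (BondConfig (Fin n)))
    with htoc
  set pocb := μ.real ((openConn u v)ᶜ ∩ (openConn v c)ᶜ ∩ openConn v o : Set (BondConfig (Fin n))) with hpocb
  set fU := μ.real ((openConn u v)ᶜ ∩ (openConn v c)ᶜ ∩ U : Set (BondConfig (Fin n))) with hfU
  set fUo := μ.real ((openConn u v)ᶜ ∩ (openConn v c)ᶜ ∩ (U ∩ openConn v o) : Set (BondConfig (Fin n))) with hfUo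
  set d := μ.real ((openConn u v)ᶜ : Set (BondConfig (Fin n))) with hd
  set dvo := μ.real ((openConn u v)ᶜ ∩ openConn v o : Set (BondConfig (Fin n))) with hdvo
  -- hPA : fU * pocb ≤ fUo * pcb;  h3 : toc * (pc * pcb) ≤ t * (d * poc - dvo * pc);  hD : d = pc + pcb;  hDo : dvo = poc + pocb
  have hpc0 : 0 ≤ pc := measureReal_nonneg
  have hpcb0 : 0 ≤ pcb := measureReal_nonneg
  have ht0 : 0 ≤ t := measureReal_nonneg
  have htoc0 : 0 ≤ toc := measureReal_nonneg
  have hfU0 : 0 ≤ fU := measureReal_nonneg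
  have hfUo0 : 0 ≤ fUo := measureReal_nonneg
  have hd0 : 0 ≤ d := measureReal_nonneg
  -- goal G: toc * (d * pc - (pc + fU) * pc) ≤ t * (d * (poc + fUo) - (pc + fU) * dvo); identity pcb * G-slack = ...
  have key : 0 ≤ pcb * (t * (d * (poc + fUo) - (pc + fU) * dvo) - toc * (d * pc - (pc + fU) * pc)) := by
    have e3 : 0 ≤ (pcb - fU) * (t * (d * poc - dvo * pc) - toc * (pc * pcb)) :=
      mul_nonneg (sub_nonneg.2 hfU_le) (sub_nonneg.2 h3)
    have ePA : 0 ≤ d * t * (fUo * pcb - fU * pocb) := mul_nonneg (mul_nonneg hd0 ht0) (sub_nonneg.2 hPA)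
    have iden : pcb * (t * (d * (poc + fUo) - (pc + fU) * dvo) - toc * (d * pc - (pc + fU) * pc)) =
        (pcb - fU) * (t * (d * poc - dvo * pc) - toc * (pc * pcb)) + d * t * (fUo * pcb - fU * pocb) := by
      rw [hD, hDo]; ring
    rw [iden]; exact add_nonneg e3 ePA
  rcases eq_or_lt_of_le hpcb0 with h0 | hpos
  · -- pcb = 0 : then t = toc = fU = fUo = pocb = 0 and both sides vanish
    have ht_zero : t = 0 := le_antisymm (h0 ▸ ht_le) ht0
    have htoc_zero : toc = 0 := le_antisymm (ht_zero ▸ htoc_le) htoc0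
    have hfU_zero : fU = 0 := le_antisymm (h0 ▸ hfU_le) hfU0
    rw [ht_zero, htoc_zero, hfU_zero]
    nlinarith
  · have := (mul_nonneg_iff_of_pos_left hpos).1 key
    linarith

end

end Summit.CriticalPhenomena.PercolationContinuityZ3.Theorems
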